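import Summits.ABC.IUTFork.LDHGenuineHullRegimeMixedPoint
import HarnessLib

/-!
# The fork at [IUTchIII] Corollary 3.12, L-DH level, READING (U): the hull estimate at `(λ, l)` WITH THE MIXED SHARE ADDED —
# part 1, datum level: (ii′-U) with the honest constant `B_III + ((l+1)/24)·H_mix` at every `d_mod`
# (abc-iut cell, R2 S-chain team seat abc-iut-s2-p1 gen 3, «HVOL-MIX-ADDITIVE»; crux ThetaPartII = stmt-ABC-19678)

Record-only PROOF file (D-0012) of the abc-iut cell; TAKES NO SIDE on [IUTchIII] Cor. 3.12 or on the (U)/(P) readings of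
"−|log(Θ)|". Mochizuki, *Inter-universal Teichmüller theory IV* (RIMS manuscript Apr. 2020 = PRIMS **57** (2021)), Thm. 1.10 proof
Steps (ii)–(viii) pp. 24–30; Cor. 2.2 (ii) proof p. 46 ((P5), (P7)); Dupuy–Hilado [DupuyHilado2025] §3.3, §3.6, §4.7, §4.11–4.12.

THE POINT. The lineage's SUFFICIENCY file `LDHGenuineHullRegimeMixedPoint` (p438083) proved the CONE binder `hvol` at `(λ, l)` from the
THRESHOLD condition «`((l+1)/24)·H_mix ≤` Step-(iii)/(viii) slack of `B_III`»; its NECESSITY files (p446116, p446417) proved that `hvol`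
FORCES «`((l+1)/24)·H_mix·(1 − tail) ≤ B_III − gain`». This file records the ADDITIVE statement behind the threshold form — the one that
stays TRUE at every `d_mod`. Notation (spelled inline, nothing defined): `F_mod := ℚ(j(λ)) = IntermediateField.adjoin ℚ {j(λ)} ⊆ F_tpd`;
a place `V` of `F_mod` is (P5)-bad iff `ord_V j(λ) < 0`, `V ∤ 2`, `V ∤ l`; `h♭(V) := (−ord_V j(λ))·log N(V)/n_V` at bad `V`, `0` otherwise;
a prime `p` is MIXED iff `h♭` is not constant on the places of `F_mod` above `p`; `H_mix(M) := Σ_{p∈M} Σ_{V|p bad} Pr(V)·h♭(V)`;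
`B_III(P,l) := ((l+1)/4)·{(1+12d_mod/l)(lD+lC) + 2 log l + 52 + (20/3)·log(d*l)·π(d*l)}` (the registered bytes), `d* := 2¹²·3³·5·d_mod`,
`lD := log-diff(λ)`, `lC := Cor22.logCondAvoid P {2,l}`.

* `PointDict.hullEstimateOf_BIII_sub_slack_add_slotResidue` — for `λ ∈ U_P` minimal, `7 ≤ l`, EVERY datum `T`:
  `T.HullEstimateOf (B_III − ((l+1)/4)·{(4(d_mod−1)/l)·(lD+lC) + (20/3)·log(d*l)·(π(d*l) − #{p ∈ T(I) : p ≤ d*l})} + slotResidue(T))`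
  — the additive content of p434699's `hullEstimateOf_BIII_of_slotResidue_le_szpiroSlack`;
* `PointDict.slotResidue_le_mixedLocalHeight` / `slotResidue_le_pointMixedHeight` — `slotResidue(T) ≤ ((l+1)/24)·Σ_{p ∈ T(I) mixed} Σ_{v|p bad}
  Pr(v)·(−ord_v j_E)·log N(v)/n_v ≤ ((l+1)/24)·H_mix(M)` for every finite `M ⊇` the mixed primes of `λ` (abc-iut-s2-p2's
  `PilotData.slotResidue_le_mixedShare`, abc-iut-S7's `mu_eq`, p437274's transport `sum_badHeight_weight_eq_point`);
* **`PointDict.hullEstimateOf_BIII_sub_slack_add_pointMixedHeight`** / **`hullEstimateOf_BIII_add_pointMixedHeight`** — for `λ ∈ U_P` minimal,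
  `7 ≤ l`, EVERY datum `T`, ANY finite `M ⊇` mixed primes: `T.HullEstimateOf (B_III P l + ((l+1)/24)·H_mix(M))` UNCONDITIONALLY (sharp form: print's
  unused conductor share `((l+1)/4)(4(d_mod−1)/l)(lD+lC)` and the datum-free `π`-slack SUBTRACTED).
The `∀ T` forms, the binder-shaped `Conditional.hvolMix_holds` and the binder-free squeeze live in part 2 (`Conditional/AbcOfSHvolMixAdditive`).

HONEST SCOPE: compositions BY NAME of landed theorems; no datum constructed; no definitions; no side taken on Cor. 3.12 / Thm. 1.10 or on
any author; typed ≠ proved; refuted-as-typed ≠ refuted-in-print.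
[cite: Mochizuki2012, IUTchIV Thm. 1.10 proof Steps (ii)–(viii) p. 24–30] [cite: Mochizuki2012, IUTchIV Cor. 2.2 (ii) proof p. 46]
[cite: DupuyHilado2025, §3.3, §3.6, §4.7, §4.11–4.12] [claim: Mochizuki2012, status: disputed] for every IUT quotation.
-/

noncomputable section

namespace Summit.ABC.IUTFork

open NumberField IsDedekindDomain Literature.IUT.LogVolume Literature.IUT.HodgeTheaters
open Literature.NumberTheory.DiophantineGeometry.GenEll
open scoped Classical

namespace PointDict

variable {P : NFPoint} {l : ℕ}

/-- `log((2^12·3^3·5·d)·l) ≥ 0` for `d, l ≥ 1`. [cite: Mochizuki2012, IUTchIV Thm. 1.10 p. 22] -/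
private theorem log_dstar_mul_nonneg₇ {d l : ℕ} (hd : 1 ≤ d) (hl : 1 ≤ l) :
    0 ≤ Real.log (((2 ^ 12 * 3 ^ 3 * 5 * d : ℕ) : ℝ) * l) := by
  apply Real.log_nonneg
  have h1 : (1 : ℝ) ≤ ((2 ^ 12 * 3 ^ 3 * 5 * d : ℕ) : ℝ) := by exact_mod_cast (by nlinarith : 1 ≤ 2 ^ 12 * 3 ^ 3 * 5 * d)
  have h2 : (1 : ℝ) ≤ (l : ℝ) := by exact_mod_cast hl
  nlinarith

/-! ## 1. Datum level: the ADDITIVE hull estimate `B_III − slack(T) + slotResidue(T)` -/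

/-- **READING (U), NO HYPOTHESIS ON THE DATUM: `T.HullEstimateOf (B_III − slack(T) + slotResidue(T))`.** For `λ ∈ U_P` (minimally
presented), `l ≥ 7` and EVERY genuine Θ-volume datum `T` at `(P, l)`:
`T.HullEstimateOf (B_III(P,l) − (l+1)/4·{(4(d_mod−1)/l)·(log-diff + log-cond) + (20/3)·log(d*·l)·(π(d*·l) − #{p ∈ T(I) : p ≤ d*·l})} + slotResidue(T))`
— the additive statement behind abc-iut-s2-p1's threshold lemma `hullEstimateOf_BIII_of_slotResidue_le_szpiroSlack` (p434699): abc-iut-c312-d1's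
`DHData.hullEstimateOf_ofInput_min_explicit` (`HullEstimateOf (δ_explicit + slotResidue)`, every input) at `N := d*·l`, abc-iut-S1's (R4)
`R4_towerFact`, the Step (ii)/(iii) bounds (`sum_dite_localDegree_mul_differentOrd_le_ndeg`, `ndeg_differentDivisor_le`,
`sum_log_supportPrimes_le_pinned`) and print's tower arithmetic with the conductor share kept (`deltaK_add_condShare_le_BIII`).
[cite: Mochizuki2012, IUTchIV Thm. 1.10 proof Steps (ii)–(viii) p. 24–30] [cite: DupuyHilado2025, §4.7, §4.12]
[claim: Mochizuki2012, status: disputed] -/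
theorem hullEstimateOf_BIII_sub_slack_add_slotResidue (T : Cor22.ThetaVolumeDatumAt P l) (hP : P ∈ UP) (h7 : 7 ≤ l) :
    T.HullEstimateOf (((l : ℝ) + 1) / 4 * ((1 + 12 * (Cor22.dmod P : ℝ) / l) * (P.logDiff + Cor22.logCondAvoid P {2, l})
      + 2 * Real.log l + 52 + 20 / 3 * Real.log (((2 ^ 12 * 3 ^ 3 * 5 * Cor22.dmod P : ℕ) : ℝ) * (l : ℝ))
        * (Nat.primeCounting (2 ^ 12 * 3 ^ 3 * 5 * Cor22.dmod P * l) : ℝ))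
      - ((l : ℝ) + 1) / 4 * (4 * ((Cor22.dmod P : ℝ) - 1) / l * (P.logDiff + Cor22.logCondAvoid P {2, l})
          + 20 / 3 * Real.log (((2 ^ 12 * 3 ^ 3 * 5 * Cor22.dmod P : ℕ) : ℝ) * l)
            * ((Nat.primeCounting (2 ^ 12 * 3 ^ 3 * 5 * Cor22.dmod P * l) : ℝ)
              - (letI := T.instFieldF; letI := T.instNumberFieldF; letI := T.instFieldK; letI := T.instNumberFieldK
                 letI := T.instAlgebraK
                 ((T.I.supportPrimes.filter (· ≤ 2 ^ 12 * 3 ^ 3 * 5 * Cor22.dmod P * l)).card : ℝ))))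
      + (letI := T.instFieldF; letI := T.instNumberFieldF; letI := T.instFieldK; letI := T.instNumberFieldK
         letI := T.instAlgebraK
         T.I.X.slotResidue T.I.supportPrimes)) := by
  classical
  letI := T.instFieldF; letI := T.instNumberFieldF; letI := T.instAlgebraF; letI := T.instFieldK
  letI := T.instNumberFieldK; letI := T.instAlgebraK; letI := T.instFieldFbar; letI := T.instAlgebraFbar
  letI := T.instAlgebraKFbar; letI := T.instIsElliptic
  have hU : P.InU := hP.1
  have h5 : 5 ≤ l := by omega
  have hl1 : 1 ≤ l := by omega
  have hd : 1 ≤ Cor22.dmod P := Cor22.dmod_pos P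
  have hXl : ((T.I.X.l : ℕ) : ℝ) = (l : ℝ) := by exact_mod_cast T.isVolumeInputOf.l_eq
  haveI : IsGalois (fieldOfModuli T.E) T.K := T.isGalois_fieldOfModuli_K
  have hprimes : ∀ p ∈ T.I.supportPrimes, p.Prime := fun p hp => T.I.prime_of_mem_supportPrimes hp
  have hlmod := log_dstar_mul_nonneg₇ hd hl1
  -- S-a in the `λ_min` form: `HullEstimateOf (δ_explicit + slotResidue)`, every datum, (R4) by abc-iut-S1
  have h0 := DHData.hullEstimateOf_ofInput_min_explicit T.I (2 ^ 12 * 3 ^ 3 * 5 * Cor22.dmod P * l) hlmod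
    (T.R4_towerFact hP)
  rw [hXl] at h0
  -- `A ≤ log 𝔡^K ≤ log-diff + log 𝔣 + 2·log l + 21`
  have hA1 := sum_dite_localDegree_mul_differentOrd_le_ndeg (fieldOfModuli T.E) T.K T.I.σ T.I.supportPrimes hprimes
  have hA2 := T.ndeg_differentDivisor_le hU h7
  have hA : (∑ p ∈ T.I.supportPrimes, if hp : p.Prime then haveI : Fact p.Prime := ⟨hp⟩
        (∑ v : placesOver (fieldOfModuli T.E) p, (localDegree (fieldOfModuli T.E) v.1 : ℝ) *
          differentOrd p ((T.I.σ.localFieldFamily p hp).k v)) / Module.finrank ℚ (fieldOfModuli T.E) * Real.log p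
        else 0) ≤ P.logDiff + Cor22.logCondAvoid P {2, l} + 2 * Real.log l + 21 := hA1.trans hA2
  -- `B ≤ 2·d_mod·(log-diff + log 𝔣) + log(30·l)`
  have hB := T.sum_log_supportPrimes_le_pinned hP
  -- tower arithmetic with the conductor share kept
  have hδ := deltaK_add_condShare_le_BIII (P := P) h5 hA hB
  have e : (((2 ^ 12 * 3 ^ 3 * 5 * Cor22.dmod P : ℕ) : ℝ) * l) = ((2 : ℝ) ^ 12 * 3 ^ 3 * 5 * (Cor22.dmod P) * l) := by
    push_cast; ring
  rw [e] at h0 hδ ⊢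
  refine T.hullEstimateOf_mono h0 ?_
  have hc0 : (0 : ℝ) ≤ ((l : ℝ) + 1) / 4 := by positivity
  -- `δ_explicit(count) = δ_explicit(π) + condShare − {condShare + slack_π(T)} ≤ B_III − {condShare + slack_π(T)}`
  nlinarith [hδ, hc0]

/-! ## 2. The slot residue is at most the MIXED share — datum and point currencies -/

/-- **`slotResidue(T) ≤ ((l+1)/24)·(weighted bad local height of `j_E` at the MIXED support primes of the datum).** For a genuine
Θ-volume datum `T` at `(P, l)`: `slotResidue(T) ≤ ((l+1)/24)·Σ_{p ∈ T(I) mixed} Σ_{v|p, v ∈ 𝕍^bad_mod} Pr(v)·(−ord_v(j_E))·log N(v)/n_v`,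
«`p` mixed» = the datum's `q`-orders are NOT constant over the places of `F_mod` above `p` (prime by prime the negation of v4's `hreg`
regime clause) — abc-iut-s2-p2's `PilotData.slotResidue_le_mixedShare` (the residue lives on the non-slot-constant primes) read in the
printed quantities by abc-iut-S7's `mu_eq` and `avgSq_eq` (`(ℓ⋆+1)(2ℓ⋆+1)/6 = l(l+1)/12`, `μ_T(v) = (−ord_v j_E)/(2l)·log N(v)/n_v`).
The inequality inside p436339's `hullEstimateOf_BIII_of_mixedLocalHeight_le_szpiroSlack'`, made a statement of its own.
[cite: Mochizuki2012, IUTchIV Thm. 1.10 proof Step (v) p. 27–28] [cite: DupuyHilado2025, §3.3, §3.6, §4.7, §4.11–4.12]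
[claim: Mochizuki2012, status: disputed] -/
theorem slotResidue_le_mixedLocalHeight (T : Cor22.ThetaVolumeDatumAt P l) :
    (letI := T.instFieldF; letI := T.instNumberFieldF; letI := T.instAlgebraF; letI := T.instFieldK
     letI := T.instNumberFieldK; letI := T.instAlgebraK; letI := T.instFieldFbar; letI := T.instAlgebraFbar
     letI := T.instAlgebraKFbar; letI := T.instIsElliptic
     T.I.X.slotResidue T.I.supportPrimes ≤
      ((l : ℝ) + 1) / 24 *
          ∑ p ∈ T.I.supportPrimes.filter (fun p => ¬ ∀ v w : placesOver (fieldOfModuli T.E) p,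
              (DHData.ofInput T.I).logQloc p v = (DHData.ofInput T.I).logQloc p w),
            ∑ v : placesOver (fieldOfModuli T.E) p,
            (if v.1 ∈ ThetaData.badPrimesMod T.D then
              weight (fieldOfModuli T.E) v.1 * (((-ord (fieldOfModuli T.E) v.1 (ThetaData.jMod T.E) : ℤ) : ℝ)
                * logNorm (fieldOfModuli T.E) v.1 / (localDegree (fieldOfModuli T.E) v.1 : ℝ))
             else 0)) := by
  letI := T.instFieldF; letI := T.instNumberFieldF; letI := T.instAlgebraF; letI := T.instFieldK
  letI := T.instNumberFieldK; letI := T.instAlgebraK; letI := T.instFieldFbar; letI := T.instAlgebraFbar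
  letI := T.instAlgebraKFbar; letI := T.instIsElliptic
  have hprimes : ∀ p ∈ T.I.supportPrimes, p.Prime := fun p hp => T.I.prime_of_mem_supportPrimes hp
  have hl0 : (l : ℝ) ≠ 0 := by
    have h1 : (T.I.X.l : ℝ) = 2 * T.I.X.lstar + 1 := T.I.X.l_cast
    have h2 : ((T.I.X.l : ℕ) : ℝ) = (l : ℝ) := by exact_mod_cast T.isVolumeInputOf.l_eq
    rw [h2] at h1
    have h3 : (0 : ℝ) ≤ (T.I.X.lstar : ℝ) := Nat.cast_nonneg _
    intro h
    linarith
  set C := T.I.supportPrimes.filter (fun p => ∀ v w : placesOver (fieldOfModuli T.E) p,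
      (DHData.ofInput T.I).logQloc p v = (DHData.ofInput T.I).logQloc p w) with hCdef
  have hC : ∀ p ∈ C, ∀ v w : placesOver (fieldOfModuli T.E) p,
      (DHData.ofInput T.I).logQloc p v = (DHData.ofInput T.I).logQloc p w := fun p hp => (Finset.mem_filter.1 hp).2
  -- `logQloc`-constancy at `p ∈ C` gives `θ_i`-constancy (`θ_i(v) = (i+1)²·μ(v)`, `μ(v) = logQloc(v)/(2l)`)
  have hC' : ∀ p ∈ C, ∀ (i : Fin T.I.X.lstar) (v w : placesOver (fieldOfModuli T.E) p),
      T.I.X.slotValue i v.1 = T.I.X.slotValue i w.1 := by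
    intro p hp i v w
    have hvw := hC p hp v w
    simp only [DHData.logQloc, DHData.ofInput_X] at hvw
    have e1 : ∀ u : placesOver (fieldOfModuli T.E) p, T.I.X.slotValue i u.1 =
        (((i : ℕ) + 1 : ℝ) ^ 2) * (1 / (2 * (T.I.X.l : ℝ)) *
          (T.I.X.qDivisor u.1 * logNorm (fieldOfModuli T.E) u.1 / (localDegree (fieldOfModuli T.E) u.1 : ℝ))) := by
      intro u
      rw [PilotData.slotValue_eq_sq_mul, PilotData.qPilot_eq_smul, Finsupp.smul_apply, smul_eq_mul]
      ring
    rw [e1, e1, hvw]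
  have hres := T.I.X.slotResidue_le_mixedShare T.I.supportPrimes C hprimes hC'
  rw [avgSq_eq T, ← Finset.mul_sum] at hres
  refine hres.trans (le_of_eq ?_)
  -- `T(I) \ C` is the set of mixed support primes
  have hsd : T.I.supportPrimes \ C =
      T.I.supportPrimes.filter (fun p => ¬ ∀ v w : placesOver (fieldOfModuli T.E) p,
        (DHData.ofInput T.I).logQloc p v = (DHData.ofInput T.I).logQloc p w) := by
    rw [hCdef, Finset.filter_not]
  rw [hsd]
  -- read `μ_T(v)·Pr(v)` in printed quantities (abc-iut-S7 `mu_eq`) and move `1/(2l)` out: `l(l+1)/12 · 1/(2l) = (l+1)/24`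
  have hμ := mu_eq T
  have hterm : ∀ p ∈ T.I.supportPrimes.filter (fun p => ¬ ∀ v w : placesOver (fieldOfModuli T.E) p,
        (DHData.ofInput T.I).logQloc p v = (DHData.ofInput T.I).logQloc p w),
      ∑ v : placesOver (fieldOfModuli T.E) p,
      T.I.X.qPilot v.1 * logNorm (fieldOfModuli T.E) v.1 / (localDegree (fieldOfModuli T.E) v.1 : ℝ)
        * weight (fieldOfModuli T.E) v.1 =
      1 / (2 * (l : ℝ)) * ∑ v : placesOver (fieldOfModuli T.E) p,
        (if v.1 ∈ ThetaData.badPrimesMod T.D then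
          weight (fieldOfModuli T.E) v.1 * (((-ord (fieldOfModuli T.E) v.1 (ThetaData.jMod T.E) : ℤ) : ℝ)
            * logNorm (fieldOfModuli T.E) v.1 / (localDegree (fieldOfModuli T.E) v.1 : ℝ))
         else 0) := by
    intro p _
    rw [Finset.mul_sum]
    refine Finset.sum_congr rfl fun v _ => ?_
    rw [hμ v.1]
    split_ifs with hv
    · field_simp
    · simp
  rw [Finset.sum_congr rfl hterm, ← Finset.mul_sum]
  field_simp
  ring

/-- The point-side summand is nonnegative: `Pr(V) ≥ 0` and `h♭(V) ≥ 0` (`−ord_V j(λ) > 0` at a bad place, `log N(V) > 0`).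
[cite: DupuyHilado2025, §3.3, §3.6] -/
private theorem pointSummand_nonneg' (V : HeightOneSpectrum (𝓞 ↥(IntermediateField.adjoin ℚ ({Cor22.jInv P.x} : Set P.F)))) :
    0 ≤ (if ord _ V (Cor22.jMod P) < 0 ∧ ((2 : ℕ) : 𝓞 _) ∉ V.asIdeal ∧ ((l : ℕ) : 𝓞 _) ∉ V.asIdeal then
          weight _ V * (((-ord _ V (Cor22.jMod P) : ℤ) : ℝ) * logNorm _ V / (localDegree _ V : ℝ))
         else 0) := by
  split_ifs with h
  · refine mul_nonneg (weight_nonneg _ V) (div_nonneg (mul_nonneg ?_ (logNorm_pos _ V).le) (Nat.cast_nonneg _))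
    have : (0 : ℤ) ≤ -ord _ V (Cor22.jMod P) := by omega
    exact_mod_cast this
  · exact le_rfl

/-- **`slotResidue(T) ≤ ((l+1)/24)·H_mix(M)` in the POINT's currency.** For a genuine Θ-volume datum `T` at `(P, l)` and ANY finite set `M`
of primes containing every MIXED prime of `λ` (w.r.t. `ℚ(j(λ))`, `2`, `l`):
`slotResidue(T) ≤ ((l+1)/24)·Σ_{p∈M} Σ_{V|p bad} Pr(V)·(−ord_V j(λ))·log N(V)/n_V` — prime by prime the datum's weighted bad local heights ARE
the point's (p437274 `sum_badHeight_weight_eq_point`), the datum's mixed primes are mixed primes of the point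
(`not_pointConstant_of_not_slotConstant`), and the remaining summands are `≥ 0`. NO IUT object on the right-hand side.
[cite: Mochizuki2012, IUTchIV Thm. 1.10 proof Step (v) p. 27–28] [cite: DupuyHilado2025, §3.3, §3.6, §4.7] [claim: Mochizuki2012, status: disputed] -/
theorem slotResidue_le_pointMixedHeight (T : Cor22.ThetaVolumeDatumAt P l) (M : Finset ℕ)
    (hM : ∀ p : ℕ, p.Prime →
      (¬ ∀ V W : HeightOneSpectrum (𝓞 ↥(IntermediateField.adjoin ℚ ({Cor22.jInv P.x} : Set P.F))),
        V ∈ placesOver _ p → W ∈ placesOver _ p →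
        (if ord _ V (Cor22.jMod P) < 0 ∧ ((2 : ℕ) : 𝓞 _) ∉ V.asIdeal ∧ ((l : ℕ) : 𝓞 _) ∉ V.asIdeal
          then ((-ord _ V (Cor22.jMod P) : ℤ) : ℝ) * logNorm _ V / (localDegree _ V : ℝ) else 0) =
        (if ord _ W (Cor22.jMod P) < 0 ∧ ((2 : ℕ) : 𝓞 _) ∉ W.asIdeal ∧ ((l : ℕ) : 𝓞 _) ∉ W.asIdeal
          then ((-ord _ W (Cor22.jMod P) : ℤ) : ℝ) * logNorm _ W / (localDegree _ W : ℝ) else 0)) → p ∈ M) :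
    (letI := T.instFieldF; letI := T.instNumberFieldF; letI := T.instFieldK; letI := T.instNumberFieldK
     letI := T.instAlgebraK
     T.I.X.slotResidue T.I.supportPrimes) ≤
      ((l : ℝ) + 1) / 24 *
        ∑ p ∈ M, ∑ V : placesOver ↥(IntermediateField.adjoin ℚ ({Cor22.jInv P.x} : Set P.F)) p,
          (if ord _ V.1 (Cor22.jMod P) < 0 ∧ ((2 : ℕ) : 𝓞 _) ∉ V.1.asIdeal ∧ ((l : ℕ) : 𝓞 _) ∉ V.1.asIdeal then
            weight _ V.1 * (((-ord _ V.1 (Cor22.jMod P) : ℤ) : ℝ) * logNorm _ V.1 / (localDegree _ V.1 : ℝ))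
           else 0) := by
  letI := T.instFieldF; letI := T.instNumberFieldF; letI := T.instAlgebraF; letI := T.instFieldK
  letI := T.instNumberFieldK; letI := T.instAlgebraK; letI := T.instFieldFbar; letI := T.instAlgebraFbar
  letI := T.instAlgebraKFbar; letI := T.instIsElliptic
  set Fm : Type := ↥(IntermediateField.adjoin ℚ ({Cor22.jInv P.x} : Set P.F)) with hFm
  set FE : Type := ↥(fieldOfModuli T.E) with hFE
  have hl0 : (0 : ℝ) ≤ ((l : ℝ) + 1) / 24 := by positivity
  refine (slotResidue_le_mixedLocalHeight T).trans (mul_le_mul_of_nonneg_left ?_ hl0)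
  set MF := T.I.supportPrimes.filter (fun p => ¬ ∀ v w : placesOver FE p,
      (DHData.ofInput T.I).logQloc p v = (DHData.ofInput T.I).logQloc p w) with hMF
  -- prime by prime the sums agree (weight descent to `F` twice)
  have heq : ∑ p ∈ MF, ∑ v : placesOver FE p,
      (if v.1 ∈ ThetaData.badPrimesMod T.D then
        weight FE v.1 * (((-ord FE v.1 (ThetaData.jMod T.E) : ℤ) : ℝ) * logNorm FE v.1 / (localDegree FE v.1 : ℝ))
       else 0) =
      ∑ p ∈ MF, ∑ V : placesOver Fm p,
        (if ord Fm V.1 (Cor22.jMod P) < 0 ∧ ((2 : ℕ) : 𝓞 Fm) ∉ V.1.asIdeal ∧ ((l : ℕ) : 𝓞 Fm) ∉ V.1.asIdeal then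
          weight Fm V.1 * (((-ord Fm V.1 (Cor22.jMod P) : ℤ) : ℝ) * logNorm Fm V.1 / (localDegree Fm V.1 : ℝ))
         else 0) := by
    refine Finset.sum_congr rfl fun p hp => ?_
    haveI : Fact p.Prime := ⟨T.I.prime_of_mem_supportPrimes (Finset.mem_filter.1 hp).1⟩
    exact sum_badHeight_weight_eq_point T p
  rw [heq]
  -- the datum's mixed primes are mixed primes of the point, hence in `M`; the other summands are `≥ 0`
  refine Finset.sum_le_sum_of_subset_of_nonneg (fun p hp => ?_) (fun p _ _ => ?_)
  · obtain ⟨hpT, hnot⟩ := Finset.mem_filter.1 hp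
    haveI : Fact p.Prime := ⟨T.I.prime_of_mem_supportPrimes hpT⟩
    exact hM p (T.I.prime_of_mem_supportPrimes hpT) (not_pointConstant_of_not_slotConstant T p hnot)
  · exact Finset.sum_nonneg fun V _ => pointSummand_nonneg' V.1

/-! ## 3. The ADDITIVE hull estimate with the POINT's mixed height — datum-free right-hand side -/

/-- **READING (U), SHARP ADDITIVE FORM, DATUM-FREE CONSTANT: `T.HullEstimateOf (B_III − condShare − slack_π + ((l+1)/24)·H_mix(M))`.**
For `λ ∈ U_P` (minimally presented), `l ≥ 7`, EVERY genuine Θ-volume datum `T` at `(P, l)` and ANY finite set `M` of primes containing every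
MIXED prime of `λ`:
`T.HullEstimateOf (B_III(P,l) − (l+1)/4·{(4(d_mod−1)/l)·(lD+lC) + (20/3)·log(d*l)·max(0, π(d*l) − (2d_mod(lD+lC)+log(30l))/log 2)} + ((l+1)/24)·H_mix(M))`
— NO hypothesis on `H_mix`: §1 + §2 + the count bound `#T(I)·log 2 ≤ 2d_mod(lD+lC) + log(30l)` (abc-iut-S3 / c312-d1 `card_supportPrimes_filter_le`).
The threshold lemma p438083 `hullEstimateOf_BIII_of_pointMixedHeight_le_szpiroMax` is the case where the last summand fits into the subtracted slack.
[cite: Mochizuki2012, IUTchIV Thm. 1.10 proof Steps (ii)–(viii) p. 24–30] [cite: DupuyHilado2025, §3.3, §3.6, §4.7, §4.11–4.12]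
[claim: Mochizuki2012, status: disputed] -/
theorem hullEstimateOf_BIII_sub_slack_add_pointMixedHeight (T : Cor22.ThetaVolumeDatumAt P l) (hP : P ∈ UP) (h7 : 7 ≤ l)
    (M : Finset ℕ)
    (hM : ∀ p : ℕ, p.Prime →
      (¬ ∀ V W : HeightOneSpectrum (𝓞 ↥(IntermediateField.adjoin ℚ ({Cor22.jInv P.x} : Set P.F))),
        V ∈ placesOver _ p → W ∈ placesOver _ p →
        (if ord _ V (Cor22.jMod P) < 0 ∧ ((2 : ℕ) : 𝓞 _) ∉ V.asIdeal ∧ ((l : ℕ) : 𝓞 _) ∉ V.asIdeal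
          then ((-ord _ V (Cor22.jMod P) : ℤ) : ℝ) * logNorm _ V / (localDegree _ V : ℝ) else 0) =
        (if ord _ W (Cor22.jMod P) < 0 ∧ ((2 : ℕ) : 𝓞 _) ∉ W.asIdeal ∧ ((l : ℕ) : 𝓞 _) ∉ W.asIdeal
          then ((-ord _ W (Cor22.jMod P) : ℤ) : ℝ) * logNorm _ W / (localDegree _ W : ℝ) else 0)) → p ∈ M) :
    T.HullEstimateOf (((l : ℝ) + 1) / 4 * ((1 + 12 * (Cor22.dmod P : ℝ) / l) * (P.logDiff + Cor22.logCondAvoid P {2, l})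
      + 2 * Real.log l + 52 + 20 / 3 * Real.log (((2 ^ 12 * 3 ^ 3 * 5 * Cor22.dmod P : ℕ) : ℝ) * (l : ℝ))
        * (Nat.primeCounting (2 ^ 12 * 3 ^ 3 * 5 * Cor22.dmod P * l) : ℝ))
      - ((l : ℝ) + 1) / 4 * (4 * ((Cor22.dmod P : ℝ) - 1) / l * (P.logDiff + Cor22.logCondAvoid P {2, l})
          + 20 / 3 * Real.log (((2 ^ 12 * 3 ^ 3 * 5 * Cor22.dmod P : ℕ) : ℝ) * l)
            * max 0 (((Nat.primeCounting (2 ^ 12 * 3 ^ 3 * 5 * Cor22.dmod P * l) : ℝ)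
              - (2 * (Cor22.dmod P : ℝ) * (P.logDiff + Cor22.logCondAvoid P {2, l}) + Real.log (2 * 3 * 5 * (l : ℝ)))
                / Real.log 2)))
      + ((l : ℝ) + 1) / 24 *
        ∑ p ∈ M, ∑ V : placesOver ↥(IntermediateField.adjoin ℚ ({Cor22.jInv P.x} : Set P.F)) p,
          (if ord _ V.1 (Cor22.jMod P) < 0 ∧ ((2 : ℕ) : 𝓞 _) ∉ V.1.asIdeal ∧ ((l : ℕ) : 𝓞 _) ∉ V.1.asIdeal then
            weight _ V.1 * (((-ord _ V.1 (Cor22.jMod P) : ℤ) : ℝ) * logNorm _ V.1 / (localDegree _ V.1 : ℝ))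
           else 0)) := by
  letI := T.instFieldF; letI := T.instNumberFieldF; letI := T.instAlgebraF; letI := T.instFieldK
  letI := T.instNumberFieldK; letI := T.instAlgebraK; letI := T.instFieldFbar; letI := T.instAlgebraFbar
  letI := T.instAlgebraKFbar; letI := T.instIsElliptic
  have hl1 : 1 ≤ l := by omega
  have hd : 1 ≤ Cor22.dmod P := Cor22.dmod_pos P
  have hlmod := log_dstar_mul_nonneg₇ hd hl1
  have hc0 : (0 : ℝ) ≤ ((l : ℝ) + 1) / 4 := by positivity
  have h0 := hullEstimateOf_BIII_sub_slack_add_slotResidue T hP h7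
  have hres := slotResidue_le_pointMixedHeight T M hM
  -- `max(0, π − B) ≤ π − #{p ∈ T(I) ≤ d*l}`
  have hcntB := card_supportPrimes_filter_le T hP (2 ^ 12 * 3 ^ 3 * 5 * Cor22.dmod P * l)
  have hcntπ : (((T.I.supportPrimes.filter (· ≤ 2 ^ 12 * 3 ^ 3 * 5 * Cor22.dmod P * l)).card : ℝ)) ≤
      (Nat.primeCounting (2 ^ 12 * 3 ^ 3 * 5 * Cor22.dmod P * l) : ℝ) := by
    have hsub : T.I.supportPrimes.filter (· ≤ 2 ^ 12 * 3 ^ 3 * 5 * Cor22.dmod P * l) ⊆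
        Nat.primesLE (2 ^ 12 * 3 ^ 3 * 5 * Cor22.dmod P * l) := by
      intro p hp
      rw [Finset.mem_filter] at hp
      rw [Nat.mem_primesLE]
      exact ⟨hp.2, T.I.prime_of_mem_supportPrimes hp.1⟩
    have hc : (T.I.supportPrimes.filter (· ≤ 2 ^ 12 * 3 ^ 3 * 5 * Cor22.dmod P * l)).card ≤
        Nat.primeCounting (2 ^ 12 * 3 ^ 3 * 5 * Cor22.dmod P * l) := by
      rw [← Nat.primesLE_card_eq_primeCounting]; exact Finset.card_le_card hsub
    exact_mod_cast hc
  have hmax : max 0 (((Nat.primeCounting (2 ^ 12 * 3 ^ 3 * 5 * Cor22.dmod P * l) : ℝ)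
          - (2 * (Cor22.dmod P : ℝ) * (P.logDiff + Cor22.logCondAvoid P {2, l}) + Real.log (2 * 3 * 5 * (l : ℝ)))
            / Real.log 2)) ≤
      ((Nat.primeCounting (2 ^ 12 * 3 ^ 3 * 5 * Cor22.dmod P * l) : ℝ)
        - ((T.I.supportPrimes.filter (· ≤ 2 ^ 12 * 3 ^ 3 * 5 * Cor22.dmod P * l)).card : ℝ)) :=
    max_le (by linarith) (by linarith)
  have h2 := mul_le_mul_of_nonneg_left hmax hlmod
  have h20 := mul_le_mul_of_nonneg_left h2 (show (0 : ℝ) ≤ 20 / 3 by norm_num)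
  have h3 := mul_le_mul_of_nonneg_left h20 hc0
  refine T.hullEstimateOf_mono h0 ?_
  have e1 : ∀ x : ℝ, 20 / 3 * (Real.log (((2 ^ 12 * 3 ^ 3 * 5 * Cor22.dmod P : ℕ) : ℝ) * l) * x) =
      20 / 3 * Real.log (((2 ^ 12 * 3 ^ 3 * 5 * Cor22.dmod P : ℕ) : ℝ) * l) * x := fun x => by ring
  rw [e1, e1] at h20
  rw [e1, e1] at h3
  linarith

/-- **READING (U), CLEAN ADDITIVE FORM: `T.HullEstimateOf (B_III(P,l) + ((l+1)/24)·H_mix(M))`** for `λ ∈ U_P` (minimally presented),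
`l ≥ 7`, every genuine Θ-volume datum `T` at `(P, l)` and any finite `M ⊇` the mixed primes of `λ` — the sharp form with the nonnegative
slack (`d_mod ≥ 1`, `lD, lC ≥ 0`, `log(d*l) ≥ 0`) dropped. At a `λ` with NO mixed prime `M = ∅` is allowed and the bound is `B_III`
(p437274 `hullVolumeAtDatum_BIII_of_pointSlotConstant`). [cite: Mochizuki2012, IUTchIV Thm. 1.10 proof Steps (ii)–(viii) p. 24–30]
[cite: DupuyHilado2025, §3.3, §3.6, §4.7] [claim: Mochizuki2012, status: disputed] -/
theorem hullEstimateOf_BIII_add_pointMixedHeight (T : Cor22.ThetaVolumeDatumAt P l) (hP : P ∈ UP) (h7 : 7 ≤ l)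
    (M : Finset ℕ)
    (hM : ∀ p : ℕ, p.Prime →
      (¬ ∀ V W : HeightOneSpectrum (𝓞 ↥(IntermediateField.adjoin ℚ ({Cor22.jInv P.x} : Set P.F))),
        V ∈ placesOver _ p → W ∈ placesOver _ p →
        (if ord _ V (Cor22.jMod P) < 0 ∧ ((2 : ℕ) : 𝓞 _) ∉ V.asIdeal ∧ ((l : ℕ) : 𝓞 _) ∉ V.asIdeal
          then ((-ord _ V (Cor22.jMod P) : ℤ) : ℝ) * logNorm _ V / (localDegree _ V : ℝ) else 0) =
        (if ord _ W (Cor22.jMod P) < 0 ∧ ((2 : ℕ) : 𝓞 _) ∉ W.asIdeal ∧ ((l : ℕ) : 𝓞 _) ∉ W.asIdeal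
          then ((-ord _ W (Cor22.jMod P) : ℤ) : ℝ) * logNorm _ W / (localDegree _ W : ℝ) else 0)) → p ∈ M) :
    T.HullEstimateOf (((l : ℝ) + 1) / 4 * ((1 + 12 * (Cor22.dmod P : ℝ) / l) * (P.logDiff + Cor22.logCondAvoid P {2, l})
      + 2 * Real.log l + 52 + 20 / 3 * Real.log (((2 ^ 12 * 3 ^ 3 * 5 * Cor22.dmod P : ℕ) : ℝ) * (l : ℝ))
        * (Nat.primeCounting (2 ^ 12 * 3 ^ 3 * 5 * Cor22.dmod P * l) : ℝ))
      + ((l : ℝ) + 1) / 24 *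
        ∑ p ∈ M, ∑ V : placesOver ↥(IntermediateField.adjoin ℚ ({Cor22.jInv P.x} : Set P.F)) p,
          (if ord _ V.1 (Cor22.jMod P) < 0 ∧ ((2 : ℕ) : 𝓞 _) ∉ V.1.asIdeal ∧ ((l : ℕ) : 𝓞 _) ∉ V.1.asIdeal then
            weight _ V.1 * (((-ord _ V.1 (Cor22.jMod P) : ℤ) : ℝ) * logNorm _ V.1 / (localDegree _ V.1 : ℝ))
           else 0)) := by
  have hl1 : 1 ≤ l := by omega
  have hd : 1 ≤ Cor22.dmod P := Cor22.dmod_pos P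
  have hlmod := log_dstar_mul_nonneg₇ hd hl1
  have hc0 : (0 : ℝ) ≤ ((l : ℝ) + 1) / 4 := by positivity
  have hl0 : (0 : ℝ) < (l : ℝ) := by exact_mod_cast (show 0 < l by omega)
  have hd1 : (1 : ℝ) ≤ (Cor22.dmod P : ℝ) := by exact_mod_cast hd
  have hL : 0 ≤ P.logDiff + Cor22.logCondAvoid P {2, l} :=
    add_nonneg (NFPoint.logDiff_nonneg P) (Cor22.logCondAvoid_nonneg P {2, l})
  refine T.hullEstimateOf_mono (hullEstimateOf_BIII_sub_slack_add_pointMixedHeight T hP h7 M hM) ?_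
  have h1 : 0 ≤ 4 * ((Cor22.dmod P : ℝ) - 1) / l * (P.logDiff + Cor22.logCondAvoid P {2, l}) :=
    mul_nonneg (div_nonneg (by linarith) hl0.le) hL
  have h2 : 0 ≤ 20 / 3 * Real.log (((2 ^ 12 * 3 ^ 3 * 5 * Cor22.dmod P : ℕ) : ℝ) * l)
      * max 0 (((Nat.primeCounting (2 ^ 12 * 3 ^ 3 * 5 * Cor22.dmod P * l) : ℝ)
        - (2 * (Cor22.dmod P : ℝ) * (P.logDiff + Cor22.logCondAvoid P {2, l}) + Real.log (2 * 3 * 5 * (l : ℝ)))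
          / Real.log 2)) := mul_nonneg (mul_nonneg (by norm_num) hlmod) (le_max_left _ _)
  have h3 := mul_nonneg hc0 (add_nonneg h1 h2)
  linarith

end PointDict

end Summit.ABC.IUTFork

end
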